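import Summits.ResolutionOfSingularities.ResolutionOfSingularities.Theorems.PerronLadder
import Literature.AlgebraicGeometry.Resolution.BlowupChartRsop
import Literature.AlgebraicGeometry.Resolution.QuadraticTransformAlongPrime
import Literature.AlgebraicGeometry.Resolution.LocalBlowup
import Literature.AlgebraicGeometry.Resolution.MonomializationAlongValuation
import Literature.AlgebraicGeometry.Resolution.AlterationsEnlargingZ
import HarnessLib

/-!
# PerronSigma — decomp-res node «DefectlessLadder» (lens-1 g19, Σ₁ hygiene of «PerronLadder»), tree file
1/3 of the Σ₁ part

Content VERBATIM from the decomp-res lens-1 g19 rev 1 TREE-FACING COMPANION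
`HOME/decomp-res-lens-1/g19/tree/DefectlessLadderTree.lean`
(sha256 45a9879c65cfd008…, 1724 l, rc 0 · 0 sorry · axioms standard per the lens's `tree/*.json`; it is the tree
projection of the node
`g19/DefectlessLadder.lean` bf11eb22…, CRITIC-LEDGER row 145, decomp-res-crit-1 g5 2026-08-30T21:39:44Z «URGENT
HYGIENE (cn26)», landing plan
(K)(L)(M)(N) of the lens's WRITER.md rev 1, endorsed).  HOME = run/shared/lean/pub/decomp-res.  WHY: the landed g18 port
`PerronCharts.MonoidalStep` is REFUTABLE AS TYPED (parameter families with a repeated non-unit member;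
`not_isParamFamily_of_mul_mem`),
so the landed `PerronLadder.toricAscentRk1_three` / `closes_perron*` carry a vacuous binder `(hStep : MonoidalStep)`
— sound, not citable.
These files add the corrected statement `MonoidalStepD` (distinct non-unit members), PROVE it in kernel
(`monoidalStepD_holds`, tree file
`PerronSigmaStep`), and re-thread PART V to the Σ₁-FREE closure `closes_sigma` (tree file `PerronSigmaAscent`)
— pure additions under FRESH
names in the companion's namespace `…Theorems.DefectlessLadder`; no landed statement is edited.  Landed by
decomp-res writer g7 as SUPPORT
(helper) of the Valuative route item 0641 `LuAlphaPTorsor`; no Valuative route edit is made by the decomp-res cell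
(MonoidalStep must simply never be
filed or served as an item; the closure now runs modulo floor CP2019 + CJS2020 + Π₁ `KK05NCVAscent` + the
residual family `NonKHToricArchLU 3 3 d`
+ `PatchingRel`).

A · Σ₁ hygiene: `NonunitDistinct`, `MonoidalStepD` (the corrected port, a closed `Prop`); B · §27 the KERNEL obstruction
`not_isParamFamily_of_mul_mem`, `monoidalStep_obstruction`, `not_monoidalStep_of_chart : … → ¬
PerronLadder.MonoidalStep` (the LANDED def, from any
regular chart with a family `(x, y, x)`, `v x < v y < 1`); §28 helpers `range_fin_append`, `exists_perm_pair`.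
PROVED, 0 sorry.  The proof of
`MonoidalStepD` is the next file `PerronSigmaStep` (400-line limit).  The companion's copy of `range_fin_append` is
NOT re-landed: it is the
tree's `Literature.AlgebraicGeometry.Resolution.range_fin_append` (`AlterationsEnlargingZ`, imported; dedup.landed p792128).

## The companion's description (VERBATIM)

The node `g19/DefectlessLadder.lean` (sha256 bf11eb22…) restates PARTS I–V of the spine inside its own
 namespace.  Since 2026-08-30T21:28Z those parts are IN THE TREE (`…Theorems.ToricLadder`, `…Theorems.KaplanskyLadder`,
`…Theorems.PerronLadder`, landed by decomp-res-writer-1 from the g16/g17/g18 pins; the defs `RegChart`,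
`IsParamFamily`, `MonoidalStep`, `KK05NCVAscent`, `ToricAscentRk1`, `TratOfDefectlessBase`, `DefectlessHenselLU`,
`NonKHToricArchLU` are byte-identical to the node's).  This file contains ONLY the gen-19 material, stated over the
TREE declarations, so that the writer can land it without re-plumbing:
* A · Σ₁ hygiene: `NonunitDistinct`, `MonoidalStepD` (the corrected port; the landed `MonoidalStep` is refutable
  as typed — §27 below);
* B · PART VII §27–§28: `not_isParamFamily_of_mul_mem`, `monoidalStep_obstruction`, `not_monoidalStep_of_chart :
  … → ¬ MonoidalStep` (the LANDED def), `monoidalStepD_holds : MonoidalStepD` (kernel);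
* C · `valIndep_upgradeD` — the tree's `valIndep_upgrade` re-typed over `MonoidalStepD` with `NonunitDistinct`
  threaded through the merge induction;
* D · `exists_dedup_paramFamily` — a parameter family with repeated non-unit members is replaced by an injective one
  with the same monomials (so the LANDED `exists_initial_chart` can be used unchanged);
* E · `toricAscent_core_sigma`, `toricAscentRk1_three_sigma : CossartJannsenSaito2020Embedded → KK05NCVAscent →
  ToricAscentRk1 3` — Σ₁ DISCHARGED (supersedes the landed `toricAscentRk1_three (hStep : MonoidalStep)`);
* F · the Σ₁-free cuts and closures `…_sigma` (supersede the landed `…_perron` family): `closes_sigma (hCP) (hCJS)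
  (hAsc) (hN) (h₃) : ResolutionOfSingularities`, `root_iff_nonKHToric_sigma`, …;
* G · PART VI: `tratOfDefectlessBase_holds : TratOfDefectlessBase` (the LANDED bridge def, PROVED), and the
  discharged cell theorems `khTopBelow_of_defectlessTop'`, `defectlessHenselLU_of_kh'`, `defectlessHenselLU_three'`.
All mathematics and docstrings are those of the node (see its header and NODE-g19.md); 0 sorry.

(Sources: de Jong 1996 (2.4) / Stacks 0BIQ (blow-up charts); CossartPiltant2019; CossartJannsenSaito2020;
KnafKuhlmann2005 arXiv:math/0304159 §4 Thm 4.1; Zariski1940 §B; Cutkosky arXiv:1404.7459 §2.1; Kaplansky1942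
Lemma 5, Thm 3; Kuhlmann2010 arXiv:1003.5678 Lemma 2.4, Thm 2.14; KnafKuhlmann2009 Lemma 2.16.)
-/

noncomputable section

open IsLocalRing Literature.AlgebraicGeometry.Resolution
open Summit.ResolutionOfSingularities.ResolutionOfSingularities.Theses
open Summit.ResolutionOfSingularities.ResolutionOfSingularities.Theorems
open Summit.ResolutionOfSingularities.ResolutionOfSingularities.Theorems.PfaffLine
open Summit.ResolutionOfSingularities.ResolutionOfSingularities.Theorems.ToricLadder
open Summit.ResolutionOfSingularities.ResolutionOfSingularities.Theorems.KaplanskyLadder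
open Summit.ResolutionOfSingularities.ResolutionOfSingularities.Theorems.PerronLadder

namespace Summit.ResolutionOfSingularities.ResolutionOfSingularities.Theorems.DefectlessLadder

/-! # A · Σ₁ hygiene (node §18, REV gen 19) -/

section SigmaHygiene

variable {k : Type} [Field k] {K : Type} [Field K] [Algebra k K]

/-- **Σ₁-HYGIENE (gen 19).** `NonunitDistinct O t`: the NON-UNIT members of the family `t` (those of
value `< 1`) are pairwise distinct.  REV (gen 19, §27): the gen-18 port `MonoidalStep` quantifies over
parameter families with REPEATED non-unit members, for which its conclusion is FALSE (take a regular
system of parameters `(x, y)` of a two-dimensional regular local chart dominated by `O` with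
`0 < v y < v x`, and `t = (x, y, x)`, `i = 0`, `s = 1`: the updated family `(x/y, y, x)` would need `x`
to be a member of a regular system of parameters of a regular local ring `S₁ ∋ x/y, y` in which
`x = (x/y)·y ∈ 𝔪²` — impossible, `not_mem_sq_of_span_eq_maximalIdeal`; kernel form of the obstruction:
`not_isParamFamily_of_mul_mem`, §27).  The corrected port `MonoidalStepD` below adds this hypothesis
(and returns it for the updated family); PART V is re-threaded through it (`valIndep_upgrade`,
`exists_initial_chart`, `toricAscent_core` and every `closes_perron*` now take / produce
`MonoidalStepD` / `NonunitDistinct`), and §28 PROVES `MonoidalStepD` in kernel (`monoidalStepD_holds`). -/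
def NonunitDistinct (O : ValuationSubring K) {m : ℕ} (t : Fin m → K) : Prop :=
  ∀ j l : Fin m, O.valuation (t j) < 1 → t j = t l → j = l

end SigmaHygiene

/-- **PORT Σ₁′ · `MonoidalStepD` — the CORRECTED monoidal step (gen 19).**  `MonoidalStep` verbatim with
the hypothesis `NonunitDistinct O t` added and `NonunitDistinct O (update t i (t i / t s))` added to the
conclusion.  For such families the statement is the classical one (Zariski 1940 §B; Knaf–Kuhlmann 2005
§4 p. 9 L40–L48; Cutkosky arXiv:1404.7459 §2.1): the monoidal transform of the regular local chart `S`
along `O` with the regular two-parameter centre `(t_i, t_s)`, `t_i ≠ t_s` members of one regular system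
of parameters, is again a regular local chart of `F₁` dominated by `O`, essentially of finite type, and
`(t_s, t_i/t_s [if a non-unit], the other parameters)` is part of a regular system of parameters of it
(de Jong 1996, 2.4; Stacks 0BIQ — tree `isRsopPart_chartFamily_reesChart`).  PROVED in kernel in §28
(`monoidalStepD_holds`); kept as a `def` so that PART V's theorems stay stated modulo a named statement and
§29 discharges it (`closes_sigma`). -/
def MonoidalStepD : Prop :=
  ∀ (k K : Type) [Field k] [Field K] [Algebra k K] (O : ValuationSubring K),
    (∀ c : k, algebraMap k K c ∈ O) →
    ∀ (F₁ : IntermediateField k K) (S : Subalgebra k K), RegChart O F₁ S →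
    ∀ (m : ℕ) (t : Fin m → K), IsParamFamily O S t → NonunitDistinct O t →
    ∀ i s : Fin m, i ≠ s → O.valuation (t s) < 1 → O.valuation (t i) ≤ O.valuation (t s) →
      ∃ S₁ : Subalgebra k K, S ≤ S₁ ∧ RegChart O F₁ S₁ ∧
        IsParamFamily O S₁ (Function.update t i (t i / t s)) ∧
        NonunitDistinct O (Function.update t i (t i / t s))

/-! # PART VII — Σ₁ IN KERNEL (gen 19, NEW): the gen-18 port `MonoidalStep` is REFUTABLE AS TYPED; its
corrected form `MonoidalStepD` is PROVED -/
/-! ## 27. The defect of the gen-18 port `MonoidalStep` (KERNEL obstruction)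

`IsParamFamily O S t` allows REPEATED non-unit members (`t = (x, y, x)` for a regular system of parameters
`(x, y)` of a two-dimensional chart).  For such a family and `i = 0`, `s = 1` (`v x < v y < 1`
multiplicatively, i.e. `x` of larger value) the conclusion of `MonoidalStep` asks for a regular local chart
`S₁ ∋ x/y, y` in which `x = (x/y)·y` — a product of two non-units — is a member of a regular system of
parameters: impossible (`x ∈ 𝔪_{S₁}²`, minimal generators of `𝔪` are not in `𝔪²`).  Hence the gen-18
`closes_perron (hStep : MonoidalStep) …` had a REFUTABLE hypothesis (vacuous closure) as soon as one
regular chart with two parameters of distinct positive values exists (`not_monoidalStep_of_chart`; such charts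
exist in every function field of transcendence degree `≥ 2`, e.g. by `exists_initial_chart` — the chart is not
constructed here, so `¬ MonoidalStep` itself is not claimed in kernel).  REPAIR (§18): `NonunitDistinct` +
`MonoidalStepD`, threaded through PART V; §28 proves `MonoidalStepD`; §29 removes the hypothesis from the
closure. -/
section PartVII

variable {k : Type} [Field k] {K : Type} [Field K] [Algebra k K]

/-- **OBSTRUCTION (kernel).** A member of value `< 1` of a parameter family of a regular chart is never a
product of two elements of the chart of value `< 1` (it is a minimal generator of `𝔪`, hence `∉ 𝔪²`;
`not_mem_sq_of_span_eq_maximalIdeal`). [folklore] -/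
theorem not_isParamFamily_of_mul_mem {O : ValuationSubring K} {F₁ : IntermediateField k K}
    {S : Subalgebra k K} (hS : RegChart O F₁ S) {m : ℕ} {t : Fin m → K} (ht : IsParamFamily O S t)
    (j : Fin m) {x y : K} (hx : x ∈ S) (hy : y ∈ S) (hvx : O.valuation x < 1)
    (hvy : O.valuation y < 1) (h : t j = x * y) : False := by
  classical
  obtain ⟨hreg, hSO, -, hunit, -⟩ := hS
  obtain ⟨-, d, z, hdim, hzu, hzspan, htz⟩ := ht
  haveI : IsRegularLocalRing S := hreg
  have hvj : O.valuation (t j) < 1 := by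
    rw [h, map_mul]
    exact Right.mul_lt_one_of_le_of_lt
      ((O.valuation_le_one_iff _).mpr (hSO (Subalgebra.mem_toSubring.mpr hx))) hvy
  obtain ⟨a, ha⟩ : ∃ a, (z a : K) = t j := (htz j).resolve_right (ne_of_lt hvj)
  have hzm : ∀ j, z j ∈ maximalIdeal S := fun j => (IsLocalRing.mem_maximalIdeal _).mpr (hzu j)
  have hspan : Ideal.span (Set.range z) = maximalIdeal S := by
    refine le_antisymm (Ideal.span_le.mpr ?_)
      fun r hr => hzspan r ((IsLocalRing.mem_maximalIdeal r).mp hr)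
    rintro _ ⟨j, rfl⟩
    exact hzm j
  have hfr : (maximalIdeal S).spanFinrank = d := by
    have h1 : ((maximalIdeal S).spanFinrank : WithBot ℕ∞) = ringKrullDim S :=
      IsRegularLocalRing.spanFinrank_maximalIdeal
    rw [hdim] at h1
    exact_mod_cast h1
  have hxm : (⟨x, hx⟩ : S) ∈ maximalIdeal S :=
    (IsLocalRing.mem_maximalIdeal _).mpr fun hu => (ne_of_lt hvx) ((hunit _).mp hu)
  have hym : (⟨y, hy⟩ : S) ∈ maximalIdeal S :=
    (IsLocalRing.mem_maximalIdeal _).mpr fun hu => (ne_of_lt hvy) ((hunit _).mp hu)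
  have hcard : (Finset.univ.image z).card ≤ (maximalIdeal S).spanFinrank :=
    Finset.card_image_le.trans (by simp [hfr])
  have hspan'' : Ideal.span ((Finset.univ.image z : Finset S) : Set S) = maximalIdeal S := by
    rw [← hspan, Finset.coe_image, Finset.coe_univ, Set.image_univ]
  refine not_mem_sq_of_span_eq_maximalIdeal _ hspan'' hcard
    (Finset.mem_image_of_mem z (Finset.mem_univ a)) ?_
  have hza : z a = ⟨x, hx⟩ * ⟨y, hy⟩ := Subtype.ext (by rw [Subalgebra.coe_mul, ha, h])
  rw [hza, pow_two]
  exact Ideal.mul_mem_mul hxm hym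

/-- **The obstruction in the shape of the counterexample.**  If a regular chart `S₁` contains `x / y` and `y`,
both of value `< 1`, then `x` is a member of NO parameter family of `S₁`. [folklore] -/
theorem monoidalStep_obstruction {O : ValuationSubring K} {F₁ : IntermediateField k K}
    {S₁ : Subalgebra k K} (hS₁ : RegChart O F₁ S₁) {m : ℕ} {t' : Fin m → K}
    (ht' : IsParamFamily O S₁ t') (j : Fin m) {x y : K} (hxy : x / y ∈ S₁) (hy : y ∈ S₁)
    (hvxy : O.valuation (x / y) < 1) (hvy : O.valuation y < 1) (hy0 : y ≠ 0) (hj : t' j = x) :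
    False :=
  not_isParamFamily_of_mul_mem hS₁ ht' j hxy hy hvxy hvy (by rw [hj, div_mul_cancel₀ x hy0])

/-- **`MonoidalStep` (gen 18) IS REFUTABLE AS TYPED**: it fails as soon as ONE regular chart `S` dominated by
`O` carries a parameter family `t = (x, y, x)` with `v x < v y < 1` (apply it with `i = 0`, `s = 1`; the new
chart would contain `x/y` and `y`, non-units, and `x = t' 2` would be a parameter: `monoidalStep_obstruction`). [folklore] -/
theorem not_monoidalStep_of_chart (O : ValuationSubring K) (hk : ∀ c : k, algebraMap k K c ∈ O)
    (F₁ : IntermediateField k K) (S : Subalgebra k K) (hS : RegChart O F₁ S) (t : Fin 3 → K)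
    (ht : IsParamFamily O S t) (h20 : t 2 = t 0) (hv1 : O.valuation (t 1) < 1)
    (hv01 : O.valuation (t 0) < O.valuation (t 1)) : ¬ MonoidalStep := by
  intro hStep
  obtain ⟨S₁, -, hS₁, ht'⟩ := hStep k K O hk F₁ S hS 3 t ht 0 1 (by decide) hv1 hv01.le
  have ht10 : t 1 ≠ 0 := (ht.1 1).2
  have h0 : Function.update t 0 (t 0 / t 1) 0 = t 0 / t 1 := Function.update_self _ _ _
  have h1 : Function.update t 0 (t 0 / t 1) 1 = t 1 := Function.update_of_ne (by decide) _ _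
  have h2 : Function.update t 0 (t 0 / t 1) 2 = t 0 := by
    rw [Function.update_of_ne (by decide)]
    exact h20
  have hvq : O.valuation (t 0 / t 1) < 1 := by
    rw [map_div₀]
    exact (div_lt_one₀ (zero_lt_iff.mpr ((_root_.map_ne_zero O.valuation).mpr ht10))).mpr hv01
  exact monoidalStep_obstruction hS₁ ht' 2 (x := t 0) (y := t 1) (by rw [← h0]; exact (ht'.1 0).1)
    (by rw [← h1]; exact (ht'.1 1).1) hvq hv1 ht10 h2

/-! ## 28. `MonoidalStepD` PROVED (KERNEL) — the monoidal transform along the valuation via the tree's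
blow-up charts (`BlowupChartRsop`, `QuadraticTransformAlongPrime`, `LocalBlowup`) -/
/-- A permutation of `Fin d` sending two given distinct points to two given distinct points. [folklore] -/
theorem exists_perm_pair {d : ℕ} {p0 p1 a b : Fin d} (h01 : p0 ≠ p1) (hab : a ≠ b) :
    ∃ σ : Equiv.Perm (Fin d), σ p0 = b ∧ σ p1 = a := by
  classical
  let σ₁ : Equiv.Perm (Fin d) := Equiv.swap p0 b
  have ha' : σ₁ a ≠ p0 := by
    intro h
    have h' := congrArg σ₁ h
    rw [Equiv.swap_apply_self, Equiv.swap_apply_left] at h'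
    exact hab h'
  refine ⟨(Equiv.swap p1 (σ₁ a)).trans σ₁, ?_, ?_⟩
  · rw [Equiv.trans_apply, Equiv.swap_apply_of_ne_of_ne h01 ha'.symm]
    exact Equiv.swap_apply_left p0 b
  · rw [Equiv.trans_apply, Equiv.swap_apply_left, Equiv.swap_apply_self]

end PartVII

end Summit.ResolutionOfSingularities.ResolutionOfSingularities.Theorems.DefectlessLadder
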